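import Mathlib.Analysis.SpecialFunctions.Pow.Real
import Literature.RepresentationTheory.FiniteGroups.IrreducibleCharacters
import Summits.MatrixMultiplication.MatrixMultiplication.Theorems.LevelGradedCohnUmansGradedDesignFamilyStubWreathBudgetIndex

/-!
# Stub `stub_tilingUniversality` for the line `tiling-families` of `LevelGradedCohnUmans.GradedDesignFamily`

Regime II of the family criterion ("asymptotically perfect graded tilings"): a fixed
block-to-dimension ratio `lam > 1` and, for every efficiency `η < 1`, a finite host `G` with a
bi-invariant test space `J ≤ ℂ^G`, wall `D = Σ_{χ ∈ Irr G ∩ J} χ(1)² > 0`, `t` simultaneously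
`J`-separated blocks `(X_i, Y_i, Z_i)` with `(lam · χ(1))³ ≤ V_i := |X_i| |Y_i| |Z_i|` for every
block `i` and every visible irreducible `χ`, and `η · D ≤ Σ_i V_i^{2/3}` — yield, for every
`ε > 0`, a graded simultaneous family at exponent `2 + ε`:
`Σ_{χ ∈ Irr G ∩ J} χ(1)^{2+ε} < Σ_i V_i^{(2+ε)/3}`.

The proof is power-mean bookkeeping, reduced to the landed lemmas of this crux
(`wreathBudget_one_le_re`: visible degrees are `≥ 1`; `irrChars_finite_holds`): choose
`η := lam^{-ε/2}` (so `η < 1 < η · lam^ε`), let `m` be the largest visible degree; then the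
graded budget is `≤ m^ε · D` termwise, while every block has `V_i^{ε/3} ≥ (lam m)^ε`, so the
value is `≥ (lam m)^ε Σ_i V_i^{2/3} ≥ (lam m)^ε η D = (η lam^ε) · m^ε D > m^ε D`.
[cite: CohnKleinbergSzegedyUmans2005, Thm. 5.5]
-/

noncomputable section

set_option linter.dupNamespace false

open scoped BigOperators
open Literature.RepresentationTheory.FiniteGroups

namespace Summit.MatrixMultiplication.MatrixMultiplication.Theorems.GradedDesignFamily.TilingUniversalityK15

/-- Choice of the efficiency: for `1 < lam` and `0 < ε` there is `η < 1` with `1 < η · lam^ε`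
(namely `η = lam^{-ε/2}`, for which `η · lam^ε = lam^{ε/2}`). [folklore] -/
theorem exists_eta {lam ε : ℝ} (hlam : 1 < lam) (hε : 0 < ε) :
    ∃ η : ℝ, η < 1 ∧ 1 < η * lam ^ ε := by
  have hlam0 : 0 < lam := one_pos.trans hlam
  refine ⟨lam ^ (-(ε / 2)), Real.rpow_lt_one_of_one_lt_of_neg hlam (by linarith), ?_⟩
  rw [← Real.rpow_add hlam0, show -(ε / 2) + ε = ε / 2 by ring]
  exact Real.one_lt_rpow hlam (by linarith)

/-- Termwise budget bound: if `0 < d ≤ m` and `0 ≤ ε` then `d^{2+ε} ≤ d² · m^ε`. [folklore] -/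
theorem rpow_two_add_le_mul {d m ε : ℝ} (hd : 0 < d) (hdm : d ≤ m) (hε : 0 ≤ ε) :
    d ^ (2 + ε) ≤ d ^ (2 : ℝ) * m ^ ε := by
  rw [Real.rpow_add hd]
  exact mul_le_mul_of_nonneg_left (Real.rpow_le_rpow hd.le hdm hε) (Real.rpow_nonneg hd.le _)

/-- Termwise value bound: if `0 < a`, `a³ ≤ V` and `0 ≤ ε` then `a^ε · V^{2/3} ≤ V^{(2+ε)/3}`
(since `a^ε = (a³)^{ε/3} ≤ V^{ε/3}`). [folklore] -/
theorem rpow_mul_rpow_le {a V ε : ℝ} (ha : 0 < a) (hV : a ^ (3 : ℕ) ≤ V) (hε : 0 ≤ ε) :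
    a ^ ε * V ^ ((2 : ℝ) / 3) ≤ V ^ ((2 + ε) / 3) := by
  have hV0 : 0 < V := (pow_pos ha 3).trans_le hV
  have h3 : a ^ ε = (a ^ (3 : ℕ)) ^ (ε / 3) := by
    rw [← Real.rpow_natCast, ← Real.rpow_mul ha.le]
    congr 1
    push_cast
    ring
  have h1 : a ^ ε ≤ V ^ (ε / 3) := by
    rw [h3]
    exact Real.rpow_le_rpow (pow_nonneg ha.le 3) hV (div_nonneg hε (by norm_num))
  calc a ^ ε * V ^ ((2 : ℝ) / 3) ≤ V ^ (ε / 3) * V ^ ((2 : ℝ) / 3) :=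
        mul_le_mul_of_nonneg_right h1 (Real.rpow_nonneg hV0.le _)
    _ = V ^ ((2 + ε) / 3) := by
        rw [← Real.rpow_add hV0]
        congr 1
        ring

/-- **The real-analytic core of `stub_tilingUniversality`.**  A finite index set `S` with
"degrees" `d χ ≥ 1` and wall `D = Σ_{χ ∈ S} (d χ)² > 0`, "volumes" `V i ≥ (lam · d χ)³` for all
`i` and all `χ ∈ S` (`lam > 0`), an efficiency `η` with `η · D ≤ Σ_i (V i)^{2/3}` and
`1 < η · lam^ε` (`ε > 0`) force `Σ_{χ ∈ S} (d χ)^{2+ε} < Σ_i (V i)^{(2+ε)/3}`.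
[cite: CohnKleinbergSzegedyUmans2005, Thm. 5.5] -/
theorem sum_rpow_lt_sum_rpow {α : Type*} (S : Finset α) (d : α → ℝ) (t : ℕ) (V : Fin t → ℝ)
    (lam η ε : ℝ) (hlam : 0 < lam) (hε : 0 < ε) (hkey : 1 < η * lam ^ ε)
    (hd : ∀ χ ∈ S, 1 ≤ d χ) (hD : 0 < ∑ χ ∈ S, d χ ^ (2 : ℝ))
    (hvol : ∀ i : Fin t, ∀ χ ∈ S, (lam * d χ) ^ (3 : ℕ) ≤ V i)
    (hη : η * ∑ χ ∈ S, d χ ^ (2 : ℝ) ≤ ∑ i, V i ^ ((2 : ℝ) / 3)) :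
    ∑ χ ∈ S, d χ ^ (2 + ε) < ∑ i, V i ^ ((2 + ε) / 3) := by
  -- the index set is non-empty since the wall is positive
  have hS : S.Nonempty := by
    by_contra h
    rw [Finset.not_nonempty_iff_eq_empty] at h
    rw [h, Finset.sum_empty] at hD
    exact lt_irrefl _ hD
  -- the largest degree `m ≥ 1`
  obtain ⟨χ₀, hχ₀, hmax⟩ := Finset.exists_max_image S d hS
  set m := d χ₀ with hm
  set D := ∑ χ ∈ S, d χ ^ (2 : ℝ) with hDdef
  have hm0 : 0 < m := one_pos.trans_le (hd χ₀ hχ₀)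
  have ha : 0 < lam * m := mul_pos hlam hm0
  -- (1) the graded budget is at most `m^ε · D`
  have hbud : ∑ χ ∈ S, d χ ^ (2 + ε) ≤ m ^ ε * D := by
    calc ∑ χ ∈ S, d χ ^ (2 + ε) ≤ ∑ χ ∈ S, d χ ^ (2 : ℝ) * m ^ ε :=
          Finset.sum_le_sum fun χ hχ =>
            rpow_two_add_le_mul (one_pos.trans_le (hd χ hχ)) (hmax χ hχ) hε.le
      _ = m ^ ε * D := by rw [← Finset.sum_mul, mul_comm]
  -- (2) the value is at least `(lam m)^ε · η · D`
  have hval : (lam * m) ^ ε * (η * D) ≤ ∑ i, V i ^ ((2 + ε) / 3) := by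
    calc (lam * m) ^ ε * (η * D) ≤ (lam * m) ^ ε * ∑ i, V i ^ ((2 : ℝ) / 3) :=
          mul_le_mul_of_nonneg_left hη (Real.rpow_nonneg ha.le _)
      _ = ∑ i, (lam * m) ^ ε * V i ^ ((2 : ℝ) / 3) := by rw [Finset.mul_sum]
      _ ≤ ∑ i, V i ^ ((2 + ε) / 3) :=
          Finset.sum_le_sum fun i _ => rpow_mul_rpow_le ha (hvol i χ₀ hχ₀) hε.le
  -- (3) comparison: `η · lam^ε > 1` and `m^ε · D > 0`
  have hpos : 0 < m ^ ε * D := mul_pos (Real.rpow_pos_of_pos hm0 _) hD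
  calc ∑ χ ∈ S, d χ ^ (2 + ε) ≤ m ^ ε * D := hbud
    _ = 1 * (m ^ ε * D) := (one_mul _).symm
    _ < (η * lam ^ ε) * (m ^ ε * D) := mul_lt_mul_of_pos_right hkey hpos
    _ = (lam * m) ^ ε * (η * D) := by
        rw [Real.mul_rpow hlam.le hm0.le]
        ring
    _ ≤ ∑ i, V i ^ ((2 + ε) / 3) := hval

/-- **stub_tilingUniversality — asymptotically perfect graded tilings are universal.**  A fixed
block-to-dimension ratio `lam > 1` and, for every efficiency `η < 1`, a finite host with a
bi-invariant `J`, positive wall `D = Σ_{Irr∩J} χ(1)²`, simultaneously `J`-separated blocks of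
volume `≥ (lam χ(1))³` for every visible irreducible `χ`, and `η D ≤ Σ_i V_i^{2/3}`, give a
graded simultaneous family at every exponent `2 + ε`, `ε > 0` (take `η = lam^{-ε/2}`; power
means, host-free). [cite: CohnKleinbergSzegedyUmans2005, Thm. 5.5] -/
theorem stub_tilingUniversality
    (h : ∃ lam : ℝ, 1 < lam ∧ ∀ η : ℝ, η < 1 → ∃ (G : Type) (_ : Group G) (_ : Fintype G)
      (J : Submodule ℂ (G → ℂ)) (t : ℕ) (X Y Z : Fin t → Finset G),
      (∀ f ∈ J, ∀ a b : G, (fun g : G => f (a * g * b)) ∈ J) ∧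
      (∀ i : Fin t, ∀ x₀ ∈ X i, ∀ z₀ ∈ Z i, ∃ f ∈ J, ∀ a b : Fin t,
        ∀ x ∈ X a, ∀ y ∈ Y a, ∀ y' ∈ Y b, ∀ z ∈ Z b,
          ((a = i ∧ b = i ∧ x = x₀ ∧ y = y' ∧ z = z₀) → f (x⁻¹ * y * y'⁻¹ * z) = 1) ∧
          (¬ (a = i ∧ b = i ∧ x = x₀ ∧ y = y' ∧ z = z₀) → f (x⁻¹ * y * y'⁻¹ * z) = 0)) ∧
      (0 < ∑ᶠ χ ∈ Literature.RepresentationTheory.FiniteGroups.irrChars G ∩ (J : Set (G → ℂ)),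
        (χ 1).re ^ (2 : ℝ)) ∧
      (∀ i : Fin t,
        ∀ χ ∈ Literature.RepresentationTheory.FiniteGroups.irrChars G ∩ (J : Set (G → ℂ)),
          (lam * (χ 1).re) ^ (3 : ℕ) ≤ (((X i).card * (Y i).card * (Z i).card : ℕ) : ℝ)) ∧
      (η * ∑ᶠ χ ∈ Literature.RepresentationTheory.FiniteGroups.irrChars G ∩ (J : Set (G → ℂ)),
        (χ 1).re ^ (2 : ℝ) ≤
        ∑ i, (((X i).card * (Y i).card * (Z i).card : ℕ) : ℝ) ^ ((2 : ℝ) / 3)))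
    (ε : ℝ) (hε : 0 < ε) :
    ∃ (G : Type) (_ : Group G) (_ : Fintype G) (J : Submodule ℂ (G → ℂ)) (t : ℕ)
      (X Y Z : Fin t → Finset G),
      (∀ f ∈ J, ∀ a b : G, (fun g : G => f (a * g * b)) ∈ J) ∧
      (∀ i : Fin t, ∀ x₀ ∈ X i, ∀ z₀ ∈ Z i, ∃ f ∈ J, ∀ a b : Fin t,
        ∀ x ∈ X a, ∀ y ∈ Y a, ∀ y' ∈ Y b, ∀ z ∈ Z b,
          ((a = i ∧ b = i ∧ x = x₀ ∧ y = y' ∧ z = z₀) → f (x⁻¹ * y * y'⁻¹ * z) = 1) ∧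
          (¬ (a = i ∧ b = i ∧ x = x₀ ∧ y = y' ∧ z = z₀) → f (x⁻¹ * y * y'⁻¹ * z) = 0)) ∧
      (∑ᶠ χ ∈ Literature.RepresentationTheory.FiniteGroups.irrChars G ∩ (J : Set (G → ℂ)),
        (χ 1).re ^ (2 + ε)) <
        ∑ i, (((X i).card * (Y i).card * (Z i).card : ℕ) : ℝ) ^ ((2 + ε) / 3) := by
  obtain ⟨lam, hlam, hfam⟩ := h
  obtain ⟨η, hη1, hkey⟩ := exists_eta hlam hε
  obtain ⟨G, _instG, _instF, J, t, X, Y, Z, hJ, hsep, hD, hvol, hη⟩ := hfam η hη1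
  refine ⟨G, inferInstance, inferInstance, J, t, X, Y, Z, hJ, hsep, ?_⟩
  have hfin : (irrChars G ∩ (J : Set (G → ℂ))).Finite :=
    (irrChars_finite_holds G).subset Set.inter_subset_left
  rw [finsum_mem_eq_finite_toFinset_sum _ hfin] at hD hη
  rw [finsum_mem_eq_finite_toFinset_sum _ hfin]
  exact sum_rpow_lt_sum_rpow hfin.toFinset (fun χ => (χ 1).re) t
    (fun i => (((X i).card * (Y i).card * (Z i).card : ℕ) : ℝ)) lam η ε (one_pos.trans hlam) hε
    hkey (fun χ hχ => wreathBudget_one_le_re (hfin.mem_toFinset.mp hχ).1) hD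
    (fun i χ hχ => hvol i χ (hfin.mem_toFinset.mp hχ)) hη

end Summit.MatrixMultiplication.MatrixMultiplication.Theorems.GradedDesignFamily.TilingUniversalityK15

end
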